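/-
Copyright (c) 2026 the pub-hodgecm-mathlib formalisation cell (harness21).  Prover seat hodgecm-mathlib-F0P2-p06 (g10), 2026-09-01.  Road «S3-tree» (architect A-p16 (g30) A-88 (8)),
brick T3′ «depth-zero κ-transfer» (HEAD v4 clause `depthZeroKappaTransfer_hyperspecial_typeTwo`, P-2 assembly holder F0P2-p06 (g10)), population (P-2) TYPE (2): organ (R0²)
«THE LEVEL-ONE ROW» — the `hK₀` row of the ★ type-(2) socket p846003 from the E-internal Cayley∕Möbius shift: `n₀(δ₊) − n₀(δ₋) = (−q)^{n−2}·W₂(N−1)`.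
-/
import Literature.NumberTheory.Rogawski1990.TypeTwoCayleyShiftIntegralCM                     -- ★ FILE γ₅ (this seat); brings ★ γ₄ γ₃ γ₂ γ₁ α β
import Literature.NumberTheory.Rogawski1990.DepthZeroKappaTransferTypeTwoUnitRow                -- ★ p846128 (F0P3a-p04 (g16)): `exists_haar_normalised_isCanonical`; brings the ★ values p842319∕p842360, ★ `flicker_theorem18n`
import Literature.NumberTheory.Automorphic.ResiduallyTrivialFixedCosetCountCayley              -- ★ ROW-0 = #FIX(Y) `ncard_fixedBy_rankStratum_zero_eq_natCard_fixedBy_of_mem_adjoin` (A-p12 (g21))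
import Literature.NumberTheory.Automorphic.FixedCosetsTransport                                 -- ★ `natCard_fixedCosets_eq` (F0P3-p02)
import Literature.NumberTheory.Automorphic.UnitaryUnitOrbitalIntegralFixedPoints                -- ★ `classOrbitalIntegral_indicator_complex_cmLocalIntegralLevel_eq_natCard_fixedBy` (F0P3a-p04)
import Literature.NumberTheory.Automorphic.NonsplitPlaceHaarBallRatios                          -- ★ `isUnit_toLocalRing_uniformizer`, `conjLocal_toLocalRing_uniformizer`, `valued_toLocalRing_uniformizer_apply`
import Literature.NumberTheory.Automorphic.WhittakerCoeffLocalDatum                             -- ★ `isUniformizingElement_of_valued_eq`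
import HarnessLib

/-!
# THE LEVEL-ONE ROW of the type-(2) socket: `n₀(δ₊) − n₀(δ₋) = (−q)^{n−2} · W₂(N−1)`, by the Cayley∕Möbius shift over `L_w`

Topic `NumberTheory/Rogawski1990`; namespace `Literature.NumberTheory.Rogawski1990`.  THEOREMS ONLY (no definition, no instance, no notation, no named fact, no `sorry`); kernel lane
`--supports stmt-HodgeConjecture-24833`.  Cell `pub/hodgecm-mathlib`, crux H413; road «S3-tree», brick T3′ (HEAD v4 clause `…_typeTwo`; census
`F0/P2/F0P2-p06/g10/CENSUS-T3prime-P2-assembly.F0P2p06g10.md` §3, hand-off `…/HANDOFF-P2-RowZero.F0P2p06g10.md` (δ)).  HONEST LABEL: HC_CM is proved only modulo the cell's 2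
remaining named inputs (hLiu418, h413) until rung 0 closes; this file is an ASSEMBLY over ★ material and asserts nothing printed.

THE MATHEMATICS.  For a deep `G`-regular type-(2) `γ_H = (g, u)` at a non-split unramified good-reduction place `w ∣ v` (`v ∤ 2`) with exponents `(n, N)`, `n ≥ 2`, `N ≥ 1`, and `γ_H` in
`V` (`g_w ≡ 1`, `u_w ≡ 1 (mod ϖ)` entrywise), and a match `δ` with `κ_v(γ_H, δ) = ±1`: the residually-trivial stratum count `n₀(δ) = #{q ∈ Fix_δ(G′_v⧸K_v) : (q⁻¹δq)_w ≡ 1}` is the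
FULL fixed-point count of the CAYLEY∕MÖBIUS SHIFT `δ′ = φ_ϖ(δ)` (★ ROW-0 = #FIX(Y) with the shifted-order memberships ★ γ₄, transported to `G′_v ⧸ K_v` by ★ `natCard_fixedCosets_eq`), which is
the unit orbital integral `Φ(⟦δ′⟧, 1_K)` (★ F0P3a-p04) `= phiTHn q (n−2) (N−1)` resp. `phiTHprimen q (n−2) (N−1)` (★ values p842319∕p842360 at the SHIFTED pair `(γ_H′, δ′)`: matching and κ
kept ★ γ₂, binders ★ γ₃∕γ₅).  Flicker's Theorem 18 at `(n−2, N−1)` (★ `flicker_theorem18n`; `n−2 ≤ 2N−1`, parity kept) gives the row `hK₀` of the ★ socket.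

* §1 `exists_shifted_pair_of_typeTwo` — the shifted pair `(γ_H′, δ′)` with all ★-binders and `n₀(δ) = Nat.card Fix_{δ′}(G′_v ⧸ K_v)`.
* §2 `ncard_rankStrata_zero_eq_phiTHn_of_finKappaAt_eq_one`, `ncard_rankStrata_zero_eq_phiTHprimen_of_finKappaAt_eq_neg_one`.
* §3 **`ncard_rankStrata_zero_sub_eq_neg_pow_mul_phiHtwo`** (THE LEVEL-ONE ROW `hK₀`).

## References
* [Flicker1998UnitaryFL] Y. Z. Flicker, *Elementary proof of the fundamental lemma for a unitary group*, Canad. J. Math. 50 (1998), Thm. 18 p. 97; Props. 11, 16, 17.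
* [Rogawski1990] J. D. Rogawski, *Automorphic Representations of Unitary Groups in Three Variables* (1990), §4.9 Prop. 4.9.1 (b) p. 55.
* [Kottwitz1986] R. E. Kottwitz, *Base change for unit elements of Hecke algebras*, Compositio Math. 60 (1986), §3.
-/

set_option autoImplicit false

noncomputable section

open MeasureTheory Measure NumberField IsDedekindDomain Matrix Polynomial
open scoped MatrixGroups WithZero ValuativeRel

namespace Literature.NumberTheory.Rogawski1990

open Literature.NumberTheory.Automorphic Literature.NumberTheory.Automorphic.UnitaryGroup Literature.NumberTheory.Automorphic.MoebiusShift
open Literature.NumberTheory.Automorphic.IntegralReduction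
open Literature.NumberTheory.GaloisRepresentations Literature.NumberTheory.NumberFields

variable (L : Type) [Field L] [NumberField L] [IsCMField L] (H' : Matrix (Fin 3) (Fin 3) L)
  {v : HeightOneSpectrum (𝓞 ↥(maximalRealSubfield L))}

/-! ## §1 The shifted pair with its binders, and `n₀(δ) = #Fix_{δ′}(G′_v ⧸ K_v)` -/

set_option maxHeartbeats 1600000 in
-- the carriers' types and the strata sets are large terms
/-- **THE SHIFTED PAIR**: for a deep `G`-regular type-(2) `γ_H` in `V` and a match `δ` with `κ ≠ 0`, the Cayley∕Möbius shift `(γ_H′, δ′)` exists on the carriers, is a matching pair with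
the same κ, carries the ★ value theorems' binders at `(n−2, N−1)`, and the residually-trivial stratum count of `δ` is the fixed-point count of `δ′`.
[cite: Kottwitz1986, §3] [cite: Rogawski1990, §4.9 Prop. 4.9.1 (b) p. 55] -/
theorem exists_shifted_pair_of_typeTwo (w : PlacesOver L v) (hw : IsCMField.complexConj L • w.1 = w.1) (hv : Algebra.IsUnramifiedIn (𝓞 L) v.asIdeal)
    (hH'w : IsUnit (placeForm H' w.1)) (h2 : IsUnit (2 : 𝒪[w.1.adicCompletion L]))
    {γH : (cmDatum L 2 (Matrix.of fun i j : Fin 2 => if i.val + j.val + 1 = 2 then (1 : L) else 0)).Local v ×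
      (cmDatum L 1 (Matrix.of fun i j : Fin 1 => if i.val + j.val + 1 = 1 then (1 : L) else 0)).Local v}
    (hreg : IsLocalGRegular L v γH)
    (hirr : ¬ ∃ x : w.1.adicCompletion L, (((γH.1.val : GL (Fin 2) (LocalRing L v)).val.map
        (Pi.evalRingHom (fun w' : PlacesOver L v => w'.1.adicCompletion L) w)).charpoly).IsRoot x)
    (n N : ℕ)
    (hn : Valued.v (((finCharpolyTwo L v γH).eval (finGammaTwo L v γH)) w) = WithZero.exp (-(n : ℤ)))
    (hN : Valued.v (((γH.1.val : GL (Fin 2) (LocalRing L v)).val.map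
        (Pi.evalRingHom (fun w' : PlacesOver L v => w'.1.adicCompletion L) w)).trace ^ 2 -
      4 * ((γH.1.val : GL (Fin 2) (LocalRing L v)).val.map
        (Pi.evalRingHom (fun w' : PlacesOver L v => w'.1.adicCompletion L) w)).det) = WithZero.exp (-((2 * N + 1 : ℕ) : ℤ)))
    (hn2 : 2 ≤ n) (hN1 : 1 ≤ N)
    (hg1 : ∀ i j, Valued.v ((((γH.1.val : GL (Fin 2) (LocalRing L v)).val.map (Pi.evalRingHom (fun w' : PlacesOver L v => w'.1.adicCompletion L) w)) - 1) i j) ≤ WithZero.exp (-1 : ℤ))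
    (hu1 : Valued.v (finGammaTwo L v γH w - 1) ≤ WithZero.exp (-1 : ℤ))
    (δ : (cmDatum L 3 H').Local v) (h : IsLocalNormPair L H' v γH δ) (hκ : finKappaAt L v H' γH δ ≠ 0) :
    ∃ (γH' : (cmDatum L 2 (Matrix.of fun i j : Fin 2 => if i.val + j.val + 1 = 2 then (1 : L) else 0)).Local v ×
        (cmDatum L 1 (Matrix.of fun i j : Fin 1 => if i.val + j.val + 1 = 1 then (1 : L) else 0)).Local v) (δ' : (cmDatum L 3 H').Local v),
      IsLocalNormPair L H' v γH' δ' ∧ finKappaAt L v H' γH' δ' = finKappaAt L v H' γH δ ∧ IsLocalGRegular L v γH' ∧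
      (∀ i : ℕ, ((((endoEmbLocal L v γH').val : GL (Fin 3) (LocalRing L v)).val.map
        (Pi.evalRingHom (fun w' : PlacesOver L v => w'.1.adicCompletion L) w)).charpoly.coeff i) ∈ 𝒪[w.1.adicCompletion L]) ∧
      (¬ ∃ x : w.1.adicCompletion L, (((γH'.1.val : GL (Fin 2) (LocalRing L v)).val.map
        (Pi.evalRingHom (fun w' : PlacesOver L v => w'.1.adicCompletion L) w)).charpoly).IsRoot x) ∧
      Valued.v (((finCharpolyTwo L v γH').eval (finGammaTwo L v γH')) w) = WithZero.exp (-((n - 2 : ℕ) : ℤ)) ∧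
      Valued.v (((γH'.1.val : GL (Fin 2) (LocalRing L v)).val.map
          (Pi.evalRingHom (fun w' : PlacesOver L v => w'.1.adicCompletion L) w)).trace ^ 2 -
        4 * ((γH'.1.val : GL (Fin 2) (LocalRing L v)).val.map
          (Pi.evalRingHom (fun w' : PlacesOver L v => w'.1.adicCompletion L) w)).det) = WithZero.exp (-((2 * (N - 1) + 1 : ℕ) : ℤ)) ∧
      {q : (cmDatum L 3 H').Local v ⧸ cmLocalIntegralLevel L 3 H' v |
          q ∈ MulAction.fixedBy ((cmDatum L 3 H').Local v ⧸ cmLocalIntegralLevel L 3 H' v) δ ∧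
            (redMat ((((q.out⁻¹ * δ * q.out : (cmDatum L 3 H').Local v)).val : GL (Fin 3) (LocalRing L v)).val.map
              (Pi.evalRingHom (fun w' : UnitaryGroup.PlacesOver L v => w'.1.adicCompletion L) w)) - 1).rank = 0}.ncard =
        Nat.card (MulAction.fixedBy ((cmDatum L 3 H').Local v ⧸ cmLocalIntegralLevel L 3 H' v) δ') := by
  have hsub : Subsingleton (PlacesOver L v) := PlacesOver.subsingleton_of_smul_eq (IsCMField.complexConj L) (IsCMField.complexConj_ne_one L) w hw
  -- the shift parameter `c = ι_v(ϖ_v)`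
  set c : LocalRing L v := (((isUnit_toLocalRing_uniformizer L v).unit : (LocalRing L v)ˣ) : LocalRing L v) with hcdef
  have hσc : conjLocal L (IsCMField.complexConj L) v c = c := conjLocal_toLocalRing_uniformizer L v
  have hc : Valued.v (c w) = WithZero.exp (-1 : ℤ) := valued_toLocalRing_uniformizer_apply L v w hv
  have h2v : Valued.v (2 : w.1.adicCompletion L) = 1 := by
    have h := (Valuation.integer.integers (ValuativeRel.valuation (w.1.adicCompletion L))).isUnit_iff_valuation_eq_one.1 h2
    exact (valued_eq_one_iff_valuation_eq_one w.1 (2 : w.1.adicCompletion L)).2 h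
  have hg1' : ∀ i j, Valued.v ((((γH.1.val : GL (Fin 2) (LocalRing L v)).val.map (Pi.evalRingHom (fun w' : PlacesOver L v => w'.1.adicCompletion L) w)) - 1) i j) ≤
      Valued.v (c w) := fun i j => by rw [hc]; exact hg1 i j
  have hu1' : Valued.v (finGammaTwo L v γH w - 1) ≤ Valued.v (c w) := by rw [hc]; exact hu1
  obtain ⟨-, -, -, -, hU2m, hU2p, hU1s, -, hU1m', hU1p', hU3⟩ := isUnit_shift_denominators_of_typeTwo L v w hw γH hσc hc h2v hg1' hu1' hN1 hN
  -- the shifted `H`-element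
  obtain ⟨g', hg'⟩ := exists_local_coe_eq_moebius L v 2 (Matrix.of fun i j : Fin 2 => if i.val + j.val + 1 = 2 then (1 : L) else 0) γH.1 hσc hU2m hU2p
  obtain ⟨u', hu'⟩ := exists_local_coe_eq_moebius L v 1 (Matrix.of fun i j : Fin 1 => if i.val + j.val + 1 = 1 then (1 : L) else 0) γH.2 hσc hU1m' hU1p'
  -- the shifted `G′`-element: the denominators of `δ = xιx⁻¹` are those of `ι(γ_H)`
  obtain ⟨x, hx⟩ := isConj_iff.1 h
  have hδm : ((δ.val : GL (Fin 3) (LocalRing L v)).val : Matrix (Fin 3) (Fin 3) (LocalRing L v)) =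
      (x : GL (Fin 3) (LocalRing L v)).val * (((endoEmbLocal L v γH).val : GL (Fin 3) (LocalRing L v)).val) * (x⁻¹ : GL (Fin 3) (LocalRing L v)).val := by
    rw [← hx, Units.val_mul, Units.val_mul]; rfl
  have hN3 : IsUnit (((c + 1) • (((endoEmbLocal L v γH).val : GL (Fin 3) (LocalRing L v)).val : Matrix (Fin 3) (Fin 3) (LocalRing L v)) + (c - 1) • (1 : Matrix (Fin 3) (Fin 3) (LocalRing L v))).det) := by
    rw [coe_endoEmbLocal, coe_endoGL, smul_reindex_add_smul_one, smul_fromBlocks_add_smul_one, Matrix.det_reindex_self, Matrix.det_fromBlocks_zero₁₂]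
    exact hU2p.mul hU1p'
  have hDδ : IsUnit (((c - 1) • ((δ.val : GL (Fin 3) (LocalRing L v)).val : Matrix (Fin 3) (Fin 3) (LocalRing L v)) + (c + 1) • (1 : Matrix (Fin 3) (Fin 3) (LocalRing L v))).det) := by
    rw [hδm, smul_units_conj_add_smul_one, Matrix.det_units_conj]; exact hU3
  have hNδ : IsUnit (((c + 1) • ((δ.val : GL (Fin 3) (LocalRing L v)).val : Matrix (Fin 3) (Fin 3) (LocalRing L v)) + (c - 1) • (1 : Matrix (Fin 3) (Fin 3) (LocalRing L v))).det) := by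
    rw [hδm, smul_units_conj_add_smul_one, Matrix.det_units_conj]; exact hN3
  obtain ⟨δ', hδ'⟩ := exists_local_coe_eq_moebius L v 3 H' δ hσc hDδ hNδ
  -- the package
  have hι := coe_endoEmbLocal_eq_moebius L v γH (g', u') c hg' hu' hU2m hU1m'
  have h' : IsLocalNormPair L H' v (g', u') δ' := isLocalNormPair_of_coe_eq_moebius L v H' γH (g', u') δ δ' c h hι hδ' hU3
  have hu'eq := finGammaTwo_of_coe_eq_moebius L v γH (g', u') c hu'
  obtain ⟨hN', hn', hirr', hreg'⟩ := shifted_binders_of_typeTwo L v w hw γH (g', u') hσc hc h2v hg' hu'eq hg1' hu1' hirr hn2 hN1 hn hN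
  have hκ' := finKappaAt_of_coe_eq_moebius L v H' w hw γH (g', u') δ δ' c h h' hreg hreg' hδ' hu'eq hDδ hU1s hκ
  have hint' := charpoly_coeff_endoEmbLocal_mem_of_shifted L v w hw γH (g', u') hσc hc h2v hg' hu'eq hg1' hu1' hN1 hN
  refine ⟨(g', u'), δ', h', hκ', hreg', hint', hirr', hn', hN', ?_⟩
  -- `n₀(δ) = #Fix_{δ′_w}` on the one-place model (★ ROW-0 with the memberships of ★ γ₄), then transport to `G′_v ⧸ K_v`
  obtain ⟨hY, hYi, hX⟩ := shifted_order_memberships L v w hw H' γH δ δ' hσc hc h2v hg1' hu1' hN1 hN h hδ'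
  set e := localNonsplitEquiv (IsCMField.complexConj L) H' (IsCMField.complexConj_ne_one L) w hw with he
  have hrow := ncard_fixedBy_rankStratum_zero_eq_natCard_fixedBy_of_mem_adjoin L 3 H' v w hw hH'w (isUniformizingElement_of_valued_eq L w.1 hc) δ (e δ')
    hY (by rw [Matrix.coe_units_inv]; exact hYi) hX
  rw [hrow]
  -- transport along `e`: `K_v ↔ GL₃(𝒪_w) ∩ U`
  have hK : ∀ g : (cmDatum L 3 H').Local v, g ∈ cmLocalIntegralLevel L 3 H' v ↔
      e.toMulEquiv g ∈ (glInt 3 (w.1.adicCompletion L)).subgroupOf (unitaryGroupOfForm (galAdicCompletionMap (L := L) (IsCMField.complexConj L) hw) (placeForm H' w.1)) := fun g => by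
    rw [Subgroup.mem_subgroupOf]
    exact mem_localIntegralLevel_iff_of_smul_eq (IsCMField.complexConj L) 3 H' (IsCMField.complexConj_ne_one L) w hw g
  exact (natCard_fixedCosets_eq e.toMulEquiv hK δ').symm


/-! ## §2 The two values of `n₀`: `phiTHn q (n−2) (N−1)` on the `κ = +1` class, `phiTHprimen q (n−2) (N−1)` on the `κ = −1` class -/

set_option maxHeartbeats 1600000 in
-- the carriers' types and the strata sets are large terms
/-- **`n₀(δ₊) = phiTHn q (n−2) (N−1)`**: the residually-trivial fixed-vertex count of a match `δ` with `κ_v(γ_H, δ) = +1` of a deep type-(2) `γ_H ∈ V` is the unit fixed-point count of the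
shifted pair (§1), i.e. `Φ(⟦δ′⟧, 1_K)` (★ F0P3a-p04) `= phiTHn` at the shifted exponents (★ p842319). [cite: Flicker1998UnitaryFL, Prop. 11 p. 87; Thm. 18 p. 97]
[cite: Rogawski1990, §4.9 Prop. 4.9.1 (b) p. 55] [cite: Kottwitz1986, §3] -/
theorem ncard_rankStrata_zero_eq_phiTHn_of_finKappaAt_eq_one
    (hH' : (H'.map (IsCMField.complexConj L))ᵀ = H') (w : PlacesOver L v)
    (hw : IsCMField.complexConj L • w.1 = w.1) (hv : Algebra.IsUnramifiedIn (𝓞 L) v.asIdeal)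
    (hH'w : IsUnit (placeForm H' w.1)) (hH'i : hH'w.unit ∈ glInt 3 (w.1.adicCompletion L))
    (hH'u : IsUnit H') (h2 : IsUnit (2 : 𝒪[w.1.adicCompletion L]))
    {γH : (cmDatum L 2 (Matrix.of fun i j : Fin 2 => if i.val + j.val + 1 = 2 then (1 : L) else 0)).Local v ×
      (cmDatum L 1 (Matrix.of fun i j : Fin 1 => if i.val + j.val + 1 = 1 then (1 : L) else 0)).Local v}
    (hreg : IsLocalGRegular L v γH)
    (hirr : ¬ ∃ x : w.1.adicCompletion L, (((γH.1.val : GL (Fin 2) (LocalRing L v)).val.map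
        (Pi.evalRingHom (fun w' : PlacesOver L v => w'.1.adicCompletion L) w)).charpoly).IsRoot x)
    (n N : ℕ)
    (hn : Valued.v (((finCharpolyTwo L v γH).eval (finGammaTwo L v γH)) w) = WithZero.exp (-(n : ℤ)))
    (hN : Valued.v (((γH.1.val : GL (Fin 2) (LocalRing L v)).val.map
        (Pi.evalRingHom (fun w' : PlacesOver L v => w'.1.adicCompletion L) w)).trace ^ 2 -
      4 * ((γH.1.val : GL (Fin 2) (LocalRing L v)).val.map
        (Pi.evalRingHom (fun w' : PlacesOver L v => w'.1.adicCompletion L) w)).det) = WithZero.exp (-((2 * N + 1 : ℕ) : ℤ)))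
    (hn2 : 2 ≤ n) (hN1 : 1 ≤ N)
    (hg1 : ∀ i j, Valued.v ((((γH.1.val : GL (Fin 2) (LocalRing L v)).val.map (Pi.evalRingHom (fun w' : PlacesOver L v => w'.1.adicCompletion L) w)) - 1) i j) ≤ WithZero.exp (-1 : ℤ))
    (hu1 : Valued.v (finGammaTwo L v γH w - 1) ≤ WithZero.exp (-1 : ℤ))
    (δ : (cmDatum L 3 H').Local v) (h : IsLocalNormPair L H' v γH δ) (hκ : finKappaAt L v H' γH δ = 1) :
    (({q : (cmDatum L 3 H').Local v ⧸ cmLocalIntegralLevel L 3 H' v |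
          q ∈ MulAction.fixedBy ((cmDatum L 3 H').Local v ⧸ cmLocalIntegralLevel L 3 H' v) δ ∧
            (redMat ((((q.out⁻¹ * δ * q.out : (cmDatum L 3 H').Local v)).val : GL (Fin 3) (LocalRing L v)).val.map
              (Pi.evalRingHom (fun w' : UnitaryGroup.PlacesOver L v => w'.1.adicCompletion L) w)) - 1).rank = 0}.ncard : ℕ) : ℚ) =
      Flicker1998.phiTHn (Ideal.absNorm v.asIdeal) (n - 2) (N - 1) := by
  classical
  obtain ⟨γH', δ', h', hκ', hreg', hint', hirr', hn', hN', hcount⟩ :=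
    exists_shifted_pair_of_typeTwo L H' w hw hv hH'w h2 hreg hirr n N hn hN hn2 hN1 hg1 hu1 δ h (by rw [hκ]; exact one_ne_zero)
  rw [hcount]
  -- Borel σ-algebras and a normalised Haar measure with a canonical family (the statement is measure-free)
  letI : MeasurableSpace ((cmDatum L 3 H').Local v) := borel _
  haveI : BorelSpace ((cmDatum L 3 H').Local v) := ⟨rfl⟩
  letI : ∀ γ : ((cmDatum L 3 H').Local v), MeasurableSpace (((cmDatum L 3 H').Local v) ⧸ Subgroup.centralizer ({γ} : Set ((cmDatum L 3 H').Local v))) :=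
    fun _ => borel _
  haveI : ∀ γ : ((cmDatum L 3 H').Local v), BorelSpace (((cmDatum L 3 H').Local v) ⧸ Subgroup.centralizer ({γ} : Set ((cmDatum L 3 H').Local v))) :=
    fun _ => ⟨rfl⟩
  obtain ⟨νG, _hHaar, _hright, hνG, mG, hmG⟩ := exists_haar_normalised_isCanonical L H' (v := v) hH' hH'u
  have hH'c : (H'.map (cmConjRingHom L))ᵀ = H' := by
    have e1 : H'.map (cmConjRingHom L) = H'.map (IsCMField.complexConj L) := by
      ext i j; simp [Matrix.map_apply, cmConjRingHom_apply]
    rw [e1]; exact hH'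
  have hdet : H'.det ≠ 0 := (Matrix.isUnit_iff_isUnit_det _ |>.1 hH'u).ne_zero
  have hregδ : IsRegularElt (δ'.val : GL (Fin 3) (LocalRing L v)) := isRegularElt_of_isLocalNormPair L H' v h' hreg'
  haveI : CompactSpace (Subgroup.centralizer ({δ'} : Set ((cmDatum L 3 H').Local v))) :=
    compactSpace_centralizer_of_isLocalNormPair_of_not_exists_isRoot L v w hw hH'u hv hreg' h2 hint' hirr' (N - 1) hN' δ' h'
  -- `Φ(⟦δ′⟧, 1_K) = phiTHn q (n−2) (N−1)` and `= #Fix_{δ′}(G′_v ⧸ K_v)`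
  have hval := classOrbitalIntegral_indicator_eq_phiTHn_of_finKappaAt_eq_one L H' hH' w hw hv hH'w hH'i νG hmG hνG hH'u h2 hreg' hint' hirr' (n - 2) (N - 1) hn' hN' δ' h'
    (by rw [hκ', hκ])
  rw [classOrbitalIntegral_indicator_complex_cmLocalIntegralLevel_eq_natCard_fixedBy L 3 H' v νG hH'c hdet hmG hνG δ' hregδ] at hval
  exact_mod_cast hval

set_option maxHeartbeats 1600000 in
-- the carriers' types and the strata sets are large terms
/-- **`n₀(δ₋) = phiTHprimen q (n−2) (N−1)`** — the same on the `κ = −1` class (★ p842360). [cite: Flicker1998UnitaryFL, Prop. 17 p. 97; Thm. 18 p. 97]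
[cite: Rogawski1990, §4.9 Prop. 4.9.1 (b) p. 55] [cite: Kottwitz1986, §3] -/
theorem ncard_rankStrata_zero_eq_phiTHprimen_of_finKappaAt_eq_neg_one
    (hH' : (H'.map (IsCMField.complexConj L))ᵀ = H') (w : PlacesOver L v)
    (hw : IsCMField.complexConj L • w.1 = w.1) (hv : Algebra.IsUnramifiedIn (𝓞 L) v.asIdeal)
    (hH'w : IsUnit (placeForm H' w.1)) (hH'i : hH'w.unit ∈ glInt 3 (w.1.adicCompletion L))
    (hH'u : IsUnit H') (h2 : IsUnit (2 : 𝒪[w.1.adicCompletion L]))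
    {γH : (cmDatum L 2 (Matrix.of fun i j : Fin 2 => if i.val + j.val + 1 = 2 then (1 : L) else 0)).Local v ×
      (cmDatum L 1 (Matrix.of fun i j : Fin 1 => if i.val + j.val + 1 = 1 then (1 : L) else 0)).Local v}
    (hreg : IsLocalGRegular L v γH)
    (hirr : ¬ ∃ x : w.1.adicCompletion L, (((γH.1.val : GL (Fin 2) (LocalRing L v)).val.map
        (Pi.evalRingHom (fun w' : PlacesOver L v => w'.1.adicCompletion L) w)).charpoly).IsRoot x)
    (n N : ℕ)
    (hn : Valued.v (((finCharpolyTwo L v γH).eval (finGammaTwo L v γH)) w) = WithZero.exp (-(n : ℤ)))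
    (hN : Valued.v (((γH.1.val : GL (Fin 2) (LocalRing L v)).val.map
        (Pi.evalRingHom (fun w' : PlacesOver L v => w'.1.adicCompletion L) w)).trace ^ 2 -
      4 * ((γH.1.val : GL (Fin 2) (LocalRing L v)).val.map
        (Pi.evalRingHom (fun w' : PlacesOver L v => w'.1.adicCompletion L) w)).det) = WithZero.exp (-((2 * N + 1 : ℕ) : ℤ)))
    (hn2 : 2 ≤ n) (hN1 : 1 ≤ N)
    (hg1 : ∀ i j, Valued.v ((((γH.1.val : GL (Fin 2) (LocalRing L v)).val.map (Pi.evalRingHom (fun w' : PlacesOver L v => w'.1.adicCompletion L) w)) - 1) i j) ≤ WithZero.exp (-1 : ℤ))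
    (hu1 : Valued.v (finGammaTwo L v γH w - 1) ≤ WithZero.exp (-1 : ℤ))
    (δ : (cmDatum L 3 H').Local v) (h : IsLocalNormPair L H' v γH δ) (hκ : finKappaAt L v H' γH δ = -1) :
    (({q : (cmDatum L 3 H').Local v ⧸ cmLocalIntegralLevel L 3 H' v |
          q ∈ MulAction.fixedBy ((cmDatum L 3 H').Local v ⧸ cmLocalIntegralLevel L 3 H' v) δ ∧
            (redMat ((((q.out⁻¹ * δ * q.out : (cmDatum L 3 H').Local v)).val : GL (Fin 3) (LocalRing L v)).val.map
              (Pi.evalRingHom (fun w' : UnitaryGroup.PlacesOver L v => w'.1.adicCompletion L) w)) - 1).rank = 0}.ncard : ℕ) : ℚ) =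
      Flicker1998.phiTHprimen (Ideal.absNorm v.asIdeal) (n - 2) (N - 1) := by
  classical
  obtain ⟨γH', δ', h', hκ', hreg', hint', hirr', hn', hN', hcount⟩ :=
    exists_shifted_pair_of_typeTwo L H' w hw hv hH'w h2 hreg hirr n N hn hN hn2 hN1 hg1 hu1 δ h (by rw [hκ]; norm_num)
  rw [hcount]
  letI : MeasurableSpace ((cmDatum L 3 H').Local v) := borel _
  haveI : BorelSpace ((cmDatum L 3 H').Local v) := ⟨rfl⟩
  letI : ∀ γ : ((cmDatum L 3 H').Local v), MeasurableSpace (((cmDatum L 3 H').Local v) ⧸ Subgroup.centralizer ({γ} : Set ((cmDatum L 3 H').Local v))) :=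
    fun _ => borel _
  haveI : ∀ γ : ((cmDatum L 3 H').Local v), BorelSpace (((cmDatum L 3 H').Local v) ⧸ Subgroup.centralizer ({γ} : Set ((cmDatum L 3 H').Local v))) :=
    fun _ => ⟨rfl⟩
  obtain ⟨νG, _hHaar, _hright, hνG, mG, hmG⟩ := exists_haar_normalised_isCanonical L H' (v := v) hH' hH'u
  have hH'c : (H'.map (cmConjRingHom L))ᵀ = H' := by
    have e1 : H'.map (cmConjRingHom L) = H'.map (IsCMField.complexConj L) := by
      ext i j; simp [Matrix.map_apply, cmConjRingHom_apply]
    rw [e1]; exact hH'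
  have hdet : H'.det ≠ 0 := (Matrix.isUnit_iff_isUnit_det _ |>.1 hH'u).ne_zero
  have hregδ : IsRegularElt (δ'.val : GL (Fin 3) (LocalRing L v)) := isRegularElt_of_isLocalNormPair L H' v h' hreg'
  haveI : CompactSpace (Subgroup.centralizer ({δ'} : Set ((cmDatum L 3 H').Local v))) :=
    compactSpace_centralizer_of_isLocalNormPair_of_not_exists_isRoot L v w hw hH'u hv hreg' h2 hint' hirr' (N - 1) hN' δ' h'
  have hval := classOrbitalIntegral_indicator_eq_phiTHprimen_of_finKappaAt_eq_neg_one' L H' hH' hH'u w hw hv hH'w hH'i νG hmG hνG h2 hreg' hint' (n - 2) (N - 1) hn' hN' δ' h'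
    (by rw [hκ', hκ])
  rw [classOrbitalIntegral_indicator_complex_cmLocalIntegralLevel_eq_natCard_fixedBy L 3 H' v νG hH'c hdet hmG hνG δ' hregδ] at hval
  exact_mod_cast hval

/-! ## §3 THE LEVEL-ONE ROW `hK₀` of the type-(2) socket -/

/-- **THE LEVEL-ONE ROW OF THE TYPE-(2) SOCKET** (`hK₀` of ★ `finsum_finExplicitDelta_mul_classOrbitalIntegral_eq_of_irreducible_of_strata`, p846003): for a deep `G`-regular type-(2)
`γ_H ∈ V` with exponents `(n, N)`, `2 ≤ n ≤ 2N+1`, `n` even or `n = 2N+1`, and its two matches `δ₊`, `δ₋` (`κ = ±1`):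
`n₀(δ₊) − n₀(δ₋) = (−q)^{n−2} · phiHtwo q (N−1)` — Flicker's Theorem 18 at the SHIFTED exponents, NO deepness hypothesis on `δ±`.
[cite: Flicker1998UnitaryFL, Thm. 18 p. 97] [cite: Rogawski1990, §4.9 Prop. 4.9.1 (b) p. 55] [cite: Kottwitz1986, §3] -/
theorem ncard_rankStrata_zero_sub_eq_neg_pow_mul_phiHtwo
    (hH' : (H'.map (IsCMField.complexConj L))ᵀ = H') (w : PlacesOver L v)
    (hw : IsCMField.complexConj L • w.1 = w.1) (hv : Algebra.IsUnramifiedIn (𝓞 L) v.asIdeal)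
    (hH'w : IsUnit (placeForm H' w.1)) (hH'i : hH'w.unit ∈ glInt 3 (w.1.adicCompletion L))
    (hH'u : IsUnit H') (h2 : IsUnit (2 : 𝒪[w.1.adicCompletion L]))
    {γH : (cmDatum L 2 (Matrix.of fun i j : Fin 2 => if i.val + j.val + 1 = 2 then (1 : L) else 0)).Local v ×
      (cmDatum L 1 (Matrix.of fun i j : Fin 1 => if i.val + j.val + 1 = 1 then (1 : L) else 0)).Local v}
    (hreg : IsLocalGRegular L v γH)
    (hirr : ¬ ∃ x : w.1.adicCompletion L, (((γH.1.val : GL (Fin 2) (LocalRing L v)).val.map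
        (Pi.evalRingHom (fun w' : PlacesOver L v => w'.1.adicCompletion L) w)).charpoly).IsRoot x)
    (n N : ℕ)
    (hn : Valued.v (((finCharpolyTwo L v γH).eval (finGammaTwo L v γH)) w) = WithZero.exp (-(n : ℤ)))
    (hN : Valued.v (((γH.1.val : GL (Fin 2) (LocalRing L v)).val.map
        (Pi.evalRingHom (fun w' : PlacesOver L v => w'.1.adicCompletion L) w)).trace ^ 2 -
      4 * ((γH.1.val : GL (Fin 2) (LocalRing L v)).val.map
        (Pi.evalRingHom (fun w' : PlacesOver L v => w'.1.adicCompletion L) w)).det) = WithZero.exp (-((2 * N + 1 : ℕ) : ℤ)))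
    (hn2 : 2 ≤ n) (hN1 : 1 ≤ N) (hnN : n ≤ 2 * N + 1) (hpar : Even n ∨ n = 2 * N + 1) (hq : 1 < Ideal.absNorm v.asIdeal)
    (hg1 : ∀ i j, Valued.v ((((γH.1.val : GL (Fin 2) (LocalRing L v)).val.map (Pi.evalRingHom (fun w' : PlacesOver L v => w'.1.adicCompletion L) w)) - 1) i j) ≤ WithZero.exp (-1 : ℤ))
    (hu1 : Valued.v (finGammaTwo L v γH w - 1) ≤ WithZero.exp (-1 : ℤ))
    (δp : (cmDatum L 3 H').Local v) (hp : IsLocalNormPair L H' v γH δp) (hκp : finKappaAt L v H' γH δp = 1)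
    (δm : (cmDatum L 3 H').Local v) (hm : IsLocalNormPair L H' v γH δm) (hκm : finKappaAt L v H' γH δm = -1) :
    (({q : (cmDatum L 3 H').Local v ⧸ cmLocalIntegralLevel L 3 H' v |
          q ∈ MulAction.fixedBy ((cmDatum L 3 H').Local v ⧸ cmLocalIntegralLevel L 3 H' v) δp ∧
            (redMat ((((q.out⁻¹ * δp * q.out : (cmDatum L 3 H').Local v)).val : GL (Fin 3) (LocalRing L v)).val.map
              (Pi.evalRingHom (fun w' : UnitaryGroup.PlacesOver L v => w'.1.adicCompletion L) w)) - 1).rank = 0}.ncard : ℕ) : ℚ) -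
      (({q : (cmDatum L 3 H').Local v ⧸ cmLocalIntegralLevel L 3 H' v |
          q ∈ MulAction.fixedBy ((cmDatum L 3 H').Local v ⧸ cmLocalIntegralLevel L 3 H' v) δm ∧
            (redMat ((((q.out⁻¹ * δm * q.out : (cmDatum L 3 H').Local v)).val : GL (Fin 3) (LocalRing L v)).val.map
              (Pi.evalRingHom (fun w' : UnitaryGroup.PlacesOver L v => w'.1.adicCompletion L) w)) - 1).rank = 0}.ncard : ℕ) : ℚ) =
      (-(Ideal.absNorm v.asIdeal : ℚ)) ^ (n - 2) * Flicker1998.phiHtwo (Ideal.absNorm v.asIdeal) (N - 1) := by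
  rw [ncard_rankStrata_zero_eq_phiTHn_of_finKappaAt_eq_one L H' hH' w hw hv hH'w hH'i hH'u h2 hreg hirr n N hn hN hn2 hN1 hg1 hu1 δp hp hκp,
    ncard_rankStrata_zero_eq_phiTHprimen_of_finKappaAt_eq_neg_one L H' hH' w hw hv hH'w hH'i hH'u h2 hreg hirr n N hn hN hn2 hN1 hg1 hu1 δm hm hκm]
  have hnN' : n - 2 ≤ 2 * (N - 1) + 1 := by omega
  have hpar' : Even (n - 2) ∨ n - 2 = 2 * (N - 1) + 1 := by
    rcases hpar with ⟨k, hk⟩ | h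
    · exact Or.inl ⟨k - 1, by omega⟩
    · exact Or.inr (by omega)
  exact Flicker1998.flicker_theorem18n hq hnN' hpar'

end Literature.NumberTheory.Rogawski1990

end
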